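import Summits.BirchSwinnertonDyer.BirchSwinnertonDyer.Theses.GenusKolyvaginAtTwo
import Summits.BirchSwinnertonDyer.BirchSwinnertonDyer.Theorems.GenusKolyvaginAtTwoEquivariantChebotarevAtTwoFourStructure
import Summits.BirchSwinnertonDyer.BirchSwinnertonDyer.Theorems.GenusKolyvaginAtTwoEquivariantChebotarevAtTwoDiscFieldImage

/-!
# Route `GenusKolyvaginAtTwo`, LINE 6: Q5 `EquivariantChebotarevAtTwo` AS TYPED is FALSE modulo
# ONE generic class at the discriminant field `K = ℚ(√Δ_E)` — NEGATIVE LEMMA, refined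
# (seat gk2-p2 g6; `--negative-modulo DiscFieldClassAtTwo`; sequel of p607006)

The first booking (`…FalseOfDiscFieldFourStructureAtTwo`, p607006) refuted Q5 (item
stmt-BirchSwinnertonDyer-24881) modulo the whole `𝔽₄`-structure of `H¹(K, E[2])`. The companion
helper `GenusKolyvaginAtTwoEquivariantChebotarevAtTwoFourStructure` now CONSTRUCTS that structure in
the kernel (`exists_fourStructure_of_noTransposition`: `ω = H¹(id, z)`, `ω² + ω + 1 = 0`,
`c_* ∘ ω = ω² ∘ c_*`, `ω`-stable local kernels, independence read off `Γ_{K(E[2])}`), so the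
construction hypothesis shrinks to `DiscFieldClassAtTwo`: some `(W, K, c)` in Q5's range with NO
transposition in `ρ̄_{W,2}(Γ_K)` (in nature `K = ℚ(√Δ_W)`: `A₃`) and ONE class `x ∈ H¹(K, E[2])`
generic with respect to `x^c` (`[x, ρ₁] ≠ 0 = [x^c, ρ₁]`, `[x, ρ₂] = 0 ≠ [x^c, ρ₂]` for some
`ρ₁, ρ₂ ∈ Γ_{K(E[2])}`). Witness in nature: `E : y² = x³ + x + 1` (`Δ = −496 < 0`, `j = 6912/31`,
no CM, `ρ_{E,2^∞}` onto by Dokchitser–Dokchitser (1)–(3) + the mod-`8` lift), `K = ℚ(√−31)`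
(`d_K · Δ = 124²`), and `x = u + ωv` for `c`-invariant `𝔽₂`-independent `u, v` (`H¹(K, E[2])` is
infinite: every prime of `K` split in `K(E[2])` contributes). What the tree cannot do: exhibit the
curve's `2`-adic tower (named facts only) and supply classes in `H¹(K, E[2])`.

Given `ω`, the `τ`-stable, `ℤ`-independent, `𝔽₄`-DEPENDENT family `(ωx + ω²x^c, x, x^c)`, `π = (1 2)`,
`M = Mᵢ = 1`, `N = 1`, prescription `Nv = (1, 0, 0)` satisfies every hypothesis of Q5 (restriction-
injectivity by `KolyvaginImageTwo.h1_restriction_injective_two`) and has an EMPTY prime set: at the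
place `λ = (ℓ)`, `x, x^c ∈ ker loc_λ` forces `ωx + ω²x^c ∈ ker loc_λ`.

HONEST FRAMING. Negative lemma `DiscFieldClassAtTwo → ¬ EquivariantChebotarevAtTwo` (item 24881
stays open / held); the REPAIRED statement (Q5 + the parent's binder `¬ IsSquare (d_K · (−|Δ|))`)
is PROVED: `GenusExact.equivariantChebotarevAtTwo_of_not_isSquare` (p606279). BSD is not proved by
any of this.

References: [McCallumLMS1991] §3 Cor. 3.2; [GrossLMS1991] §9 (standing hypothesis `K ⊄ ℚ(E_p)`,
Prop. 9.1); [Kolyvagin1989] Thm. B (exclusion `K ≠ ℚ(√−|Δ|)`); [LawsonWuthrich2016] Lemma 6;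
[DokchitserDokchitserMathZ2012] Thm.
-/

set_option autoImplicit false
set_option linter.dupNamespace false

noncomputable section

open scoped Classical

namespace Summit.BirchSwinnertonDyer.BirchSwinnertonDyer.Theorems.GenusExact

open WeierstrassCurve NumberField IsDedekindDomain Field Finset
open Literature.NumberTheory.GaloisRepresentations Literature.NumberTheory.EllipticCurves
open Literature.NumberTheory
open Summit.BirchSwinnertonDyer.BirchSwinnertonDyer.Theses.GenusKolyvaginAtTwo

/-- **A generic class at the discriminant field** — the hypothesis `H'` of this file's negative
lemma. Data: a globally minimal non-CM `W/ℚ` with `Δ < 0` and `ρ_{W,2^n}` onto for all `n`; an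
imaginary quadratic `K` with its non-trivial automorphism `c` such that NO element of `Γ_K` acts on
`E(K̄)[2]` as a transposition (an element fixing a non-zero `2`-torsion point fixes all of them — in
nature: `K = ℚ(√Δ_W)`, where `ρ̄_{W,2}(Γ_K) = A₃`); and ONE class `x ∈ H¹(K, E[2])` which is
generic with respect to its conjugate `x^c`: some `ρ₁, ρ₂ ∈ Γ_{K(E[2])}` have `[x, ρ₁] ≠ 0 = [x^c, ρ₁]`
and `[x, ρ₂] = 0 ≠ [x^c, ρ₂]` (in nature: any `x = u + ωv` with `u, v` `c`-invariant and
`𝔽₂`-independent; `H¹(K, E[2])` is infinite). This is the CONSTRUCTION HYPOTHESIS of the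
negative-modulo booking of item 24881 refined by this file, not a published theorem: no cite tag,
not a Literature fact. -/
structure DiscFieldClassData where
  /-- The curve `E = W/ℚ`. -/
  W : WeierstrassCurve ℚ
  /-- `W` is an elliptic curve. -/
  [isElliptic : W.IsElliptic]
  /-- `W` is a globally minimal model. -/
  [isGloballyMinimal : W.IsGloballyMinimal]
  /-- The field `K` (in nature `ℚ(√Δ_W)`). -/
  K : Type
  /-- `K` is a field. -/
  [instField : Field K]
  /-- `K` is a number field. -/
  [instNumberField : NumberField K]
  /-- The non-trivial automorphism of `K`. -/
  c : K ≃ₐ[ℚ] K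
  /-- The generic class `x ∈ H¹(K, E[2])`. -/
  x : galH1Torsion (W.baseChange K) ((2 ^ 1 : ℕ) : ℤ)
  /-- `W` has no complex multiplication. -/
  not_hasCM : ¬ W.HasCM
  /-- `Δ(W) < 0`. -/
  Δ_neg : W.Δ < 0
  /-- `K` is imaginary quadratic. -/
  isImaginaryQuadratic : IsImaginaryQuadratic K
  /-- `ρ_{W,2^n}` is onto for every `n`. -/
  surj : ∀ n : ℕ, W.HasSurjectiveModNGaloisRep (2 ^ n : ℕ)
  /-- `c ≠ 1`. -/
  c_ne_one : c ≠ 1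
  /-- No element of `Γ_K` acts on `E(K̄)[2]` as a transposition (`ρ̄_{W,2}(Γ_K) ⊆ A₃`). -/
  noTransposition : ∀ (g : absoluteGaloisGroup K)
    (u : geomTorsion (W.baseChange K) ((2 ^ 1 : ℕ) : ℤ)), u ≠ 0 → g • u = u →
      ∀ w : geomTorsion (W.baseChange K) ((2 ^ 1 : ℕ) : ℤ), g • w = w
  /-- `x` is generic with respect to `x^c` on `Γ_{K(E[2])}`. -/
  generic : ∃ ρ₁ ∈ torsionFixing (W.baseChange K) ((2 ^ 1 : ℕ) : ℤ),
    ∃ ρ₂ ∈ torsionFixing (W.baseChange K) ((2 ^ 1 : ℕ) : ℤ),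
      h1Eval (W.baseChange K) ((2 ^ 1 : ℕ) : ℤ) x ρ₁ ≠ 0 ∧
      h1Eval (W.baseChange K) ((2 ^ 1 : ℕ) : ℤ) (conjAct W c ((2 ^ 1 : ℕ) : ℤ) x) ρ₁ = 0 ∧
      h1Eval (W.baseChange K) ((2 ^ 1 : ℕ) : ℤ) x ρ₂ = 0 ∧
      h1Eval (W.baseChange K) ((2 ^ 1 : ℕ) : ℤ) (conjAct W c ((2 ^ 1 : ℕ) : ℤ) x) ρ₂ ≠ 0

/-- **`DiscFieldClassAtTwo`**: some `(W, K, c, x)` as in `DiscFieldClassData` exists. The refined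
construction hypothesis (it implies `DiscFieldFourStructureAtTwo`, below); not a published theorem:
no cite tag, not a Literature fact. -/
def DiscFieldClassAtTwo : Prop := Nonempty DiscFieldClassData

set_option maxHeartbeats 800000 in
/-- **Q5 `EquivariantChebotarevAtTwo` as typed is false, modulo ONE generic class at the
discriminant field** (`DiscFieldClassAtTwo`). The `𝔽₄`-structure `ω` comes from
`exists_fourStructure_of_noTransposition`; the family `(ωx + ω²x^c, x, x^c)` with `π = (1 2)`,
`M = Mᵢ = 1`, `N = 1` meets all hypotheses of Q5, and the admissible prescription `Nv = (1, 0, 0)`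
has no prime (the local kernel at `λ = (ℓ)` is `ω`-stable).
[cite: McCallumLMS1991, §3 Cor. 3.2 (hypothesis K ⊄ ℚ(E_p) of §3)] [cite: GrossLMS1991, §9 Prop. 9.1] -/
theorem equivariantChebotarevAtTwo_false_of_DiscFieldClassAtTwo
    (h : DiscFieldClassAtTwo) : ¬ EquivariantChebotarevAtTwo := by
  obtain ⟨D⟩ := h
  obtain ⟨W, K, c, x, hcm, hΔ, hK, hρ, hc, hA3, hgen0⟩ := D
  obtain ⟨ω, hω1, hω2, hω3, hgen⟩ := exists_fourStructure_of_noTransposition W hΔ hK hρ hc hA3 hgen0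
  intro hQ5
  -- ### basic identities (`L = 2^1` is the level of Q5 at `M = 1`)
  have hcc : c * c = 1 := mul_self_eq_one_of_isImaginaryQuadratic hK c
  have hττ : ∀ y : galH1Torsion (W.baseChange K) ((2 ^ 1 : ℕ) : ℤ),
      conjAct W c ((2 ^ 1 : ℕ) : ℤ) (conjAct W c ((2 ^ 1 : ℕ) : ℤ) y) = y :=
    fun y ↦ conjAct_conjAct_of_mul_self W hcc _ y
  have hω3' : ∀ y, ω (ω (ω y)) = y := fun y ↦ by
    have h1 := hω1 y
    have h2 := hω1 (ω y)
    have h3 : ω (ω (ω y)) - y = (ω (ω (ω y)) + ω (ω y) + ω y) - (ω (ω y) + ω y + y) := by abel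
    rw [h2, h1, sub_zero, sub_eq_zero] at h3
    exact h3
  have hωω : ∀ y, ω (ω y) = -(ω y) - y := fun y ↦ by
    rw [← sub_eq_zero, ← hω1 y]; abel
  have h2y : ∀ y : galH1Torsion (W.baseChange K) ((2 ^ 1 : ℕ) : ℤ), (2 : ℕ) • y = 0 := fun y ↦ by
    have h2 := zsmul_galH1Torsion_eq_zero (W.baseChange K) ((2 ^ 1 : ℕ) : ℤ) y
    rw [natCast_zsmul] at h2
    exact h2
  haveI : Fact (Nat.Prime 2) := ⟨Nat.prime_two⟩
  -- ### the family `(c0, x, xτ)`, `xτ = c_* x`, `c0 = ωx + ω²xτ`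
  have key : ∀ a₀ a₁ a₂ : ℤ,
      a₀ • (ω x + ω (ω (conjAct W c ((2 ^ 1 : ℕ) : ℤ) x))) + a₁ • x +
          a₂ • conjAct W c ((2 ^ 1 : ℕ) : ℤ) x =
        a₁ • x + a₀ • ω x + (a₂ - a₀) • conjAct W c ((2 ^ 1 : ℕ) : ℤ) x +
          (-a₀) • ω (conjAct W c ((2 ^ 1 : ℕ) : ℤ) x) := fun a₀ a₁ a₂ ↦ by
    rw [hωω (conjAct W c ((2 ^ 1 : ℕ) : ℤ) x), zsmul_add, zsmul_sub, zsmul_neg, sub_zsmul, neg_zsmul]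
    abel
  have hgen' : ∀ a₀ a₁ a₂ : ℤ,
      a₀ • (ω x + ω (ω (conjAct W c ((2 ^ 1 : ℕ) : ℤ) x))) + a₁ • x +
          a₂ • conjAct W c ((2 ^ 1 : ℕ) : ℤ) x = 0 →
      (2 : ℤ) ∣ a₀ ∧ (2 : ℤ) ∣ a₁ ∧ (2 : ℤ) ∣ a₂ := fun a₀ a₁ a₂ h ↦ by
    rw [key] at h
    obtain ⟨h1, h0, h20, -⟩ := hgen a₁ a₀ (a₂ - a₀) (-a₀) h
    exact ⟨h0, h1, by simpa using dvd_add h20 h0⟩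
  have hc0ne : ω x + ω (ω (conjAct W c ((2 ^ 1 : ℕ) : ℤ) x)) ≠ 0 := fun h ↦ by
    have h' := hgen' 1 0 0 (by rw [one_zsmul, zero_zsmul, zero_zsmul, add_zero, add_zero]; exact h)
    exact absurd h'.1 (by decide)
  have hxne : x ≠ 0 := fun h ↦ by
    have h' := hgen' 0 1 0 (by rw [one_zsmul, zero_zsmul, zero_zsmul, zero_add, add_zero]; exact h)
    exact absurd h'.2.1 (by decide)
  have hxτne : conjAct W c ((2 ^ 1 : ℕ) : ℤ) x ≠ 0 := fun h ↦ by
    have h' := hgen' 0 0 1 (by rw [one_zsmul, zero_zsmul, zero_zsmul, zero_add, zero_add]; exact h)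
    exact absurd h'.2.2 (by decide)
  let cs : Fin 3 → galH1Torsion (W.baseChange K) ((2 ^ 1 : ℕ) : ℤ) :=
    ![ω x + ω (ω (conjAct W c ((2 ^ 1 : ℕ) : ℤ) x)), x, conjAct W c ((2 ^ 1 : ℕ) : ℤ) x]
  let π : Fin 3 → Fin 3 := ![0, 2, 1]
  let Mi : Fin 3 → ℕ := fun _ ↦ 1
  let Nv : Fin 3 → ℕ := ![1, 0, 0]
  have hcs0 : cs 0 = ω x + ω (ω (conjAct W c ((2 ^ 1 : ℕ) : ℤ) x)) := rfl
  have hcs1 : cs 1 = x := rfl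
  have hcs2 : cs 2 = conjAct W c ((2 ^ 1 : ℕ) : ℤ) x := rfl
  have h0 : ∀ i, cs i ≠ 0 := by
    intro i; fin_cases i
    · exact hc0ne
    · exact hxne
    · exact hxτne
  have hord : ∀ i, addOrderOf (cs i) = 2 := fun i ↦
    (addOrderOf_eq_prime_iff).mpr ⟨h2y (cs i), h0 i⟩
  have hMi : ∀ i, addOrderOf (cs i) = 2 ^ Mi i := fun i ↦ by rw [hord i]; rfl
  -- `τ`-stability
  have e2 : conjAct W c ((2 ^ 1 : ℕ) : ℤ) (ω (conjAct W c ((2 ^ 1 : ℕ) : ℤ) x)) = ω (ω x) := by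
    rw [hω2, hττ]
  have e3 : conjAct W c ((2 ^ 1 : ℕ) : ℤ) (ω (ω (conjAct W c ((2 ^ 1 : ℕ) : ℤ) x))) = ω x := by
    rw [hω2, e2, hω3']
  have hτc0 : conjAct W c ((2 ^ 1 : ℕ) : ℤ) (ω x + ω (ω (conjAct W c ((2 ^ 1 : ℕ) : ℤ) x))) =
      ω x + ω (ω (conjAct W c ((2 ^ 1 : ℕ) : ℤ) x)) := by
    rw [map_add, e3, hω2, add_comm]
  have hτs : ∀ i, conjAct W c ((2 ^ 1 : ℕ) : ℤ) (cs i) = cs (π i) := by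
    intro i; fin_cases i
    · exact hτc0
    · rfl
    · exact hττ x
  -- independence
  have hind : ∀ a : Fin 3 → ℤ, ∑ i, a i • cs i = 0 → ∀ i, (addOrderOf (cs i) : ℤ) ∣ a i := by
    intro a ha i
    rw [Fin.sum_univ_three, hcs0, hcs1, hcs2] at ha
    obtain ⟨h0', h1', h2'⟩ := hgen' (a 0) (a 1) (a 2) ha
    rw [hord i]
    fin_cases i
    · exact h0'
    · exact h1'
    · exact h2'
  -- restriction-injectivity (Gross 9.1 at `2`, every quadratic `K`)
  have hsurj : W.HasSurjectiveModNGaloisRep 2 := by simpa using hρ 1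
  have hres : ∀ a : Fin 3 → ℤ, (∀ ρ ∈ torsionFixing (W.baseChange K) ((2 ^ 1 : ℕ) : ℤ),
      h1Eval (W.baseChange K) ((2 ^ 1 : ℕ) : ℤ) (∑ i, a i • cs i) ρ = 0) → ∑ i, a i • cs i = 0 :=
    fun a ha ↦ KolyvaginImageTwo.h1_restriction_injective_two W K hK.1 hsurj ha
  have hNe : ∀ i, Nv i ≤ Mi i := by
    intro i; fin_cases i <;> decide
  have hNπ : ∀ i, Nv (π i) = Nv i := by
    intro i; fin_cases i <;> rfl
  -- ### Q5 at this family with the prescription `(1, 0, 0)`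
  haveI : NeZero (1 : ℕ) := ⟨one_ne_zero⟩
  have hinf := hQ5 1 W hcm hΔ K hK hρ c hc 1 le_rfl 3 cs π h0 hτs hind hres Mi hMi Nv hNe hNπ
  obtain ⟨ℓ, hℓ⟩ := hinf.nonempty
  rw [Set.mem_setOf_eq] at hℓ
  obtain ⟨-, hKol, -, hloc⟩ := hℓ
  -- the place `λ = (ℓ)` of `K`
  have hI : (Ideal.span {(ℓ : 𝓞 K)}).IsPrime := hKol.2.2.2.2.1
  have hne : Ideal.span {(ℓ : 𝓞 K)} ≠ ⊥ := by
    rw [Ne, Ideal.span_singleton_eq_bot]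
    exact_mod_cast hKol.1.ne_zero
  let v : HeightOneSpectrum (𝓞 K) := ⟨Ideal.span {(ℓ : 𝓞 K)}, hI, hne⟩
  have hv : (ℓ : 𝓞 K) ∈ v.asIdeal := Ideal.mem_span_singleton_self _
  have h20 : ((2 ^ 0 : ℕ) : ℤ) = 1 := by norm_num
  have hx1 : x ∈ (W.baseChange K).torsionLocalKer (v.adicCompletion K) ((2 ^ 1 : ℕ) : ℤ) := by
    have h1 := (hloc 1 v hv 0).mpr (le_refl _)
    rw [h20, one_zsmul] at h1
    exact h1
  have hx2 : conjAct W c ((2 ^ 1 : ℕ) : ℤ) x ∈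
      (W.baseChange K).torsionLocalKer (v.adicCompletion K) ((2 ^ 1 : ℕ) : ℤ) := by
    have h1 := (hloc 2 v hv 0).mpr (le_refl _)
    rw [h20, one_zsmul] at h1
    exact h1
  have hx0 : ω x + ω (ω (conjAct W c ((2 ^ 1 : ℕ) : ℤ) x)) ∉
      (W.baseChange K).torsionLocalKer (v.adicCompletion K) ((2 ^ 1 : ℕ) : ℤ) := by
    intro hmem
    have h1 := (hloc 0 v hv 0).mp (by rw [h20, one_zsmul]; exact hmem)
    exact absurd h1 (by decide)
  exact hx0 (add_mem (hω3 v x hx1) (hω3 v _ (hω3 v _ hx2)))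

/-! ### Appendix (gk2-p2 g6, second landing): the Galois hypothesis discharged — `¬Q5` from the
NEGATION of the parent's binder plus one generic class -/

/-- **Q5 `EquivariantChebotarevAtTwo` as typed is false at every `(W, K)` of its range that the
parent crux EXCLUDES, given one generic class.** Binders: `W/ℚ` globally minimal, non-CM, `Δ < 0`,
`ρ_{W,2^n}` onto for all `n`; `K` imaginary quadratic with `IsSquare ((d_K : ℚ) · (−|Δ_W|))` — the
negation of the binder `¬ IsSquare ((NumberField.discr K : ℚ) * -|W.Δ|)` of `KolyvaginExactAtTwo`
(22137), i.e. `K = ℚ(√Δ_W)` —, `c ≠ 1` in `Aut(K/ℚ)`, and ONE class `x ∈ H¹(K, E[2])` generic with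
respect to `x^c` on `Γ_{K(E[2])}`. Proof: `noTransposition_of_isSquare_discr_mul` (companion helper
`…DiscFieldImage`, p608776) supplies the Galois field of `DiscFieldClassData`; then
`equivariantChebotarevAtTwo_false_of_DiscFieldClassAtTwo`. The repaired statement with the binder is
PROVED (`equivariantChebotarevAtTwo_of_not_isSquare`, p606279), so the binder is EXACTLY what
separates the true statement from the false one (given a generic class, which exists in nature since
`H¹(K, E[2])` is infinite); the excluded field is Kolyvagin's exclusion `K ≠ ℚ(√−|Δ|)` of his
Theorem B. [cite: GrossLMS1991, §9 (standing hypothesis K ⊄ ℚ(E_p))]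
[cite: DokchitserDokchitserMathZ2012, Theorem (1), proof (ℚ(E[2]) ⊃ ℚ(√Δ))] -/
theorem equivariantChebotarevAtTwo_false_of_isSquare_discr_mul_of_generic
    (W : WeierstrassCurve ℚ) [W.IsElliptic] [W.IsGloballyMinimal] (hcm : ¬ W.HasCM) (hΔ : W.Δ < 0)
    (K : Type) [Field K] [NumberField K] (hK : IsImaginaryQuadratic K)
    (hsq : IsSquare ((NumberField.discr K : ℚ) * -|W.Δ|))
    (hρ : ∀ n : ℕ, W.HasSurjectiveModNGaloisRep (2 ^ n : ℕ)) (c : K ≃ₐ[ℚ] K) (hc : c ≠ 1)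
    (x : galH1Torsion (W.baseChange K) ((2 ^ 1 : ℕ) : ℤ))
    (hgen : ∃ ρ₁ ∈ torsionFixing (W.baseChange K) ((2 ^ 1 : ℕ) : ℤ),
      ∃ ρ₂ ∈ torsionFixing (W.baseChange K) ((2 ^ 1 : ℕ) : ℤ),
        h1Eval (W.baseChange K) ((2 ^ 1 : ℕ) : ℤ) x ρ₁ ≠ 0 ∧
        h1Eval (W.baseChange K) ((2 ^ 1 : ℕ) : ℤ) (conjAct W c ((2 ^ 1 : ℕ) : ℤ) x) ρ₁ = 0 ∧
        h1Eval (W.baseChange K) ((2 ^ 1 : ℕ) : ℤ) x ρ₂ = 0 ∧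
        h1Eval (W.baseChange K) ((2 ^ 1 : ℕ) : ℤ) (conjAct W c ((2 ^ 1 : ℕ) : ℤ) x) ρ₂ ≠ 0) :
    ¬ EquivariantChebotarevAtTwo := by
  rw [isSquare_discr_mul_iff_of_Δ_neg W hΔ K] at hsq
  exact equivariantChebotarevAtTwo_false_of_DiscFieldClassAtTwo
    ⟨⟨W, K, c, x, hcm, hΔ, hK, hρ, hc, noTransposition_of_isSquare_discr_mul W K hK.1 hsq, hgen⟩⟩

end Summit.BirchSwinnertonDyer.BirchSwinnertonDyer.Theorems.GenusExact

end
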